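import Literature.Barriers.CriticalPhenomena.PlaquetteWalkYBCoefficientRigidity
import Literature.Probability.RandomPlanarGeometry.YangBaxterSAWHexBridges
import HarnessLib

/-!
# Barrier catalogue (SAWScalingLimit): the Yang–Baxter vertex identity fails at a hole root even in
Duminil-Copin–Smirnov's INTERIOR-FACES quantifier — an explicit, kernel-certified defect

Companion of `PlaquetteWalkHoleRootDefect` (the all-faces / all-boundary-roots class
`ExactPlaquetteVertexRelation` is violated by the printed weights at the ROOT plaquette of a hole
root, and is empty on the five-weight family with `u₁u₂v ≠ 0`) and of `PlaquetteWalkIsthmusRoot`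
(at ISTHMUS hole roots the identity survives at every plaquette other than the root plaquette). The
weaker, Duminil-Copin–Smirnov-style class `ExactPlaquetteVertexRelationInt` of
`PlaquetteWalkSpinRigidity` demands the relation only at INTERIOR faces (all four neighbours in the
face list) — never at a root plaquette of a hole root, which touches the hole. This file shows that
this weaker class is violated too, as soon as the root plaquette is NOT an isthmus: on the face list
`dom11` = (3 × 3 block minus its centre) ∪ {(3,1), (3,2), (2,3)}, rooted at the `E` side of the missing
centre (root plaquette `(2,1)`, whose opposite neighbour `(3,1)` IS in the list), the printed weights
at `θ = π/3` violate the relation at the INTERIOR face `(2,2)`: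

* `vertexFunctional_dom11_mul` — for arbitrary `(W, t, c)`, `F_(2,2)·t⁷` as an explicit 19-term row
  (kernel enumeration: nineteen walks from the hole root end on a side of `(2,2)`);
* `vertexFunctional_printed_dom11` — for the printed weights `(x_c, x_c², x_c², x_c², 0)` at
  `θ = π/3`, `t = y⁵`, `r = −y⁹` (`y = e^{−iπ/16}`): `F_(2,2)·t⁷ = 2 x_c¹⁸ (y³ − y¹⁵)`, nonzero
  (`y¹² ≠ 1`);
* **`not_exactPlaquetteVertexRelationInt_printed_pi_div_three`** — `ExactPlaquetteVertexRelationInt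
  (printedWeights (π/3)) t (ybCoeff (π/3))` is FALSE; named `PlaquetteWalkHoleRootDefectInterior` /
  `_holds` (D-0021 block on the named statement);
* the curve's weights in FACTORISED closed form (`ybCurve_u₁_eq` … `ybCurve_w₂_eq`:
  `u₁ = rt(1−t⁸)(t²−r²)/Q`, `u₂ = rt(1−t⁸)(1−t²r²)/Q`, `v = t⁴(t²−r²)(1−t²r²)/Q`,
  `w₁ = (t²−r²)(1−t¹⁰r²)/Q`, `w₂ = (1−t²r²)(t¹⁰−r²)/Q`), and ON THE WHOLE CURVE the interior defect
  `F_(2,2)·t⁷ = 2 r t⁸ u₁³u₂²v⁴w₁` (`vertexFunctional_dom11_ybCurve`; the nineteen terms collapse), with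
  the mirror domain `dom11m` (corner ↔ co-corner) giving `F_(2,0)·t⁷ = −2 r t⁶ u₁²u₂³v⁴w₂`;
* the rigidity chain from the INTERIOR-faces class (`coeff_eigenvector_of_exactPlaquetteVertexRelationInt`,
  `pair_rigidityInt` — F5's argument re-run on the tree's interior instances), and the CAPSTONE
  **`not_exactPlaquetteVertexRelationInt_of_ne_zero`** / named barrier `PlaquetteWalkNoInteriorRootsRelation`
  (`_holds`): the interior-faces class is EMPTY on the five-weight family with `u₁u₂v ≠ 0` — an
  interior-faces relation forces `(W, c)` onto a curve, and then the two interior instances force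
  `w₁ = w₂ = 0`, impossible at an admissible spin (`t²⁰ = 1` vs `t¹⁶ = −1`). With
  `PlaquetteWalkNoAllRootsRelation` (all faces) this closes the negative side: NO exact plaquette vertex
  relation with `u₁u₂v ≠ 0` survives hole roots, not even in Duminil-Copin–Smirnov's interior form;
* corollaries of the factorised closed forms: `ybCurve_not_noTouch` (no point of an admissible curve
  with `u₁u₂v ≠ 0` has `w₁ = w₂ = 0`), `not_exactPlaquetteVertexRelationRC_noTouch` (the NO-TOUCH no-go
  in the ROW-CONVEX class — where identities do exist) and `not_exactPlaquetteVertexRelationRC_uniform`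
  (the uniform SAW `(x, x, x, 0, 0)`, any complex `x ≠ 0`, any phase, any `c ≠ 0`: no relation even on
  row-convex face lists — it lies off all sixteen curves).

Sources: A. Glazman, I. Manolescu, arXiv:1708.00395, eq. (1), §1 Fig. 2 (θ = π/3), Lemma 2.1
[cite: GlazmanManolescu2019, Lemma 2.1]; the interior-faces quantifier and the standing hypothesis
«Ω simply connected, a ∈ ∂Ω» [cite: DuminilCopinSmirnov2012, §2 and proof of Lemma 1 (arXiv p. 4)].
Status in print: as for `PlaquetteWalkHoleRootDefect` — the relation is printed only for simply
connected domains with the root on the boundary; this file certifies an explicit NON-ISTHMUS hole-root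
configuration where it fails at an interior face (CONSOLIDATION, negative datum) and proves the
interior-faces class EMPTY on the five-weight family with `u₁u₂v ≠ 0` (negative classification inside
the typed class, corollary-grade of the lane's rigidity chain; not located in print; venture lane
«pcv-sawmu», b-engine-1 gen 11, successor car of F9; label cell pending for the capstone).

Implementation note: read via `open private … from` (nothing else is opened): the row identity
`vertexFunctional_mul_pow_eq_rowSumN`, the interior instances and forms `inst_JE/JN/JW/JS`, `formsInt`,
`forms_adjInt` and the algebra `rigidity_of_forms` of `PlaquetteWalkSpinRigidity`; the elimination
`no_two_components` of `PlaquetteWalkYBCoefficientRigidity`; `msign_mul_self` of `PlaquetteWalkSignGauge`.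
The certificate for the `π/3` value is a `linear_combination` over `2x_c = y² − y⁶ + y¹⁰ − y¹⁴` and
`y¹⁶ = −1`, found by exact polynomial division (cofactor reduced modulo `y¹⁶ + 1`); the two curve
identities are `field_simp; ring` on the factorised closed forms (found by exact symbolic
factorisation of the nineteen-term rows). The two eleven-face enumerations need
`set_option maxRecDepth 100000` for `decide`.
-/

noncomputable section

namespace Literature.Barriers.CriticalPhenomena.PlaquetteWalk

open Literature.Probability.RandomPlanarGeometry.SAW
open Literature.Probability.RandomPlanarGeometry.SAW.YangBaxter Real Complex

open private vertexFunctional_mul_pow_eq_rowSumN from Literature.Barriers.CriticalPhenomena.PlaquetteWalkSpinRigidity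

/-! ### The face list, its hole root and its interior face -/

/-- `dom11`: the `3 × 3` block minus its centre `(1,1)`, plus `(3,1)`, `(3,2)`, `(2,3)` — eleven faces
with a hole at `(1,1)` and an interior face `(2,2)`. [folklore] -/
def dom11 : List Face :=
  [(0, 0), (1, 0), (2, 0), (0, 1), (2, 1), (0, 2), (1, 2), (2, 2), (3, 2), (2, 3), (3, 1)]

/-- The hole root: the `E` side of the missing centre (= the `W` side of the root plaquette `(2,1)`,
which is NOT an isthmus: its opposite neighbour `(3,1)` is in the list). [folklore] -/
def holeRootE : MidEdge := Face.side (1, 1) .E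

/-- The hole root is a boundary root of `dom11`. [cite: GlazmanManolescu2019, §2.1 (walks start on the boundary)] -/
theorem isBoundaryRoot_holeRootE : IsBoundaryRoot dom11 holeRootE := by
  decide

/-- `(2,2)` is an INTERIOR face of `dom11` (its four neighbours `(1,2), (3,2), (2,1), (2,3)` are in
the list). [cite: DuminilCopinSmirnov2012, Lemma 1 ("for every vertex v ∈ V(Ω)")] -/
theorem isInteriorFace_dom11 : IsInteriorFace dom11 (2, 2) := by
  decide

/-- `(2,2) ∈ dom11`. [folklore] -/
private theorem face22_mem_dom11 : ((2 : ℤ), (2 : ℤ)) ∈ dom11 := by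
  decide

set_option maxRecDepth 100000 in
/-- **Kernel enumeration**: the nineteen walks of `dom11` from the hole root that end on a side of the
interior face `(2,2)`, as cleared terms (slot, `n_{u₁}, n_{u₂}, n_v, n_{w₁}, n_{w₂}`, `q + 7`). [folklore] -/
private theorem termsN_dom11 :
    termsN dom11 holeRootE (2, 2) (depth dom11) 7 =
      [⟨2, 2, 2, 3, 0, 0, 3⟩, ⟨3, 2, 3, 3, 0, 0, 2⟩, ⟨0, 3, 3, 3, 0, 1, 5⟩, ⟨1, 3, 2, 3, 0, 2, 4⟩, ⟨0, 2, 2, 4, 0, 0, 3⟩, ⟨3, 3, 2, 4, 0, 1, 0⟩, ⟨1, 3, 2, 3, 0, 0, 4⟩, ⟨3, 1, 0, 0, 0, 0, 8⟩, ⟨2, 1, 1, 0, 0, 0, 9⟩, ⟨0, 3, 3, 3, 1, 0, 13⟩, ⟨1, 3, 2, 3, 1, 1, 12⟩, ⟨0, 2, 0, 0, 0, 0, 7⟩, ⟨2, 4, 2, 3, 1, 0, 3⟩, ⟨1, 3, 2, 3, 2, 0, 4⟩, ⟨1, 1, 0, 1, 0, 0, 8⟩, ⟨0, 1, 1, 1,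 0, 0, 9⟩, ⟨2, 1, 1, 2, 0, 0, 9⟩, ⟨3, 2, 1, 1, 0, 0, 10⟩, ⟨1, 1, 2, 1, 0, 0, 8⟩] := by
  decide
set_option maxHeartbeats 400000 in -- buildfix (bf3-g31): 160k/180k FAIL, 200k PASS at accept time; line-neutral budget line
set_option maxRecDepth 100000 in
/-- **The vertex functional at the interior face `(2,2)` of `dom11` for the hole root, arbitrary
weights** (`F·t⁷` as the nineteen-term row). [cite: GlazmanManolescu2019, §2.1, eq. (2.1)]
[cite: DuminilCopinSmirnov2012, Lemma 1 (shape of the relation)] -/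
theorem vertexFunctional_dom11_mul (W : CWeights) {t : ℂ} (ht : t ≠ 0) (c : Fin 4 → ℂ) :
    vertexFunctional W t c dom11 holeRootE (2, 2) * t ^ 7 =
      c 2 * W.u₁ ^ 2 * W.u₂ ^ 2 * W.v ^ 3 * t ^ 3 +
      c 3 * W.u₁ ^ 2 * W.u₂ ^ 3 * W.v ^ 3 * t ^ 2 +
      c 0 * W.u₁ ^ 3 * W.u₂ ^ 3 * W.v ^ 3 * W.w₂ * t ^ 5 +
      c 1 * W.u₁ ^ 3 * W.u₂ ^ 2 * W.v ^ 3 * W.w₂ ^ 2 * t ^ 4 +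
      c 0 * W.u₁ ^ 2 * W.u₂ ^ 2 * W.v ^ 4 * t ^ 3 +
      c 3 * W.u₁ ^ 3 * W.u₂ ^ 2 * W.v ^ 4 * W.w₂ +
      c 1 * W.u₁ ^ 3 * W.u₂ ^ 2 * W.v ^ 3 * t ^ 4 +
      c 3 * W.u₁ * t ^ 8 +
      c 2 * W.u₁ * W.u₂ * t ^ 9 +
      c 0 * W.u₁ ^ 3 * W.u₂ ^ 3 * W.v ^ 3 * W.w₁ * t ^ 13 +
      c 1 * W.u₁ ^ 3 * W.u₂ ^ 2 * W.v ^ 3 * W.w₁ * W.w₂ * t ^ 12 +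
      c 0 * W.u₁ ^ 2 * t ^ 7 +
      c 2 * W.u₁ ^ 4 * W.u₂ ^ 2 * W.v ^ 3 * W.w₁ * t ^ 3 +
      c 1 * W.u₁ ^ 3 * W.u₂ ^ 2 * W.v ^ 3 * W.w₁ ^ 2 * t ^ 4 +
      c 1 * W.u₁ * W.v * t ^ 8 +
      c 0 * W.u₁ * W.u₂ * W.v * t ^ 9 +
      c 2 * W.u₁ * W.u₂ * W.v ^ 2 * t ^ 9 +
      c 3 * W.u₁ ^ 2 * W.u₂ * W.v * t ^ 10 +
      c 1 * W.u₁ * W.u₂ ^ 2 * W.v * t ^ 8 := by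
  have hrow := vertexFunctional_mul_pow_eq_rowSumN W ht c dom11 holeRootE (2, 2) 7 (by decide)
  rw [termsN_dom11] at hrow
  rw [hrow]
  simp only [rowSumN, List.map_cons, List.map_nil, List.sum_cons, List.sum_nil, CWeights.mono, pow_zero,
    pow_one, mul_one]
  ring

/-! ### The printed weights at `θ = π/3` and the phases in the variable `y = e^{−iπ/16}` -/

/-- The printed weights at `θ = π/3`: `(x_c, x_c², x_c², x_c², 0)` (the tree's five evaluations,
assembled). [cite: GlazmanManolescu2019, §1, Fig. 2 (θ = π/3)] -/
private theorem printedWeights_pi_div_three' : printedWeights (π / 3) =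
    ⟨(hexCriticalFugacity : ℂ), (hexCriticalFugacity : ℂ) ^ 2, (hexCriticalFugacity : ℂ) ^ 2,
      (hexCriticalFugacity : ℂ) ^ 2, 0⟩ := by
  rw [printedWeights, weightU1_pi_div_three, weightU2_pi_div_three, weightV_pi_div_three,
    weightW1_pi_div_three, weightW2_pi_div_three]
  push_cast
  rfl

/-- `y ≠ 0`. [folklore] -/
private theorem uY_ne_zero'' : uY ≠ 0 := Complex.exp_ne_zero _

/-- `y¹⁶ = −1`. [folklore] -/
private theorem uY_pow_sixteen'' : uY ^ 16 = -1 := by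
  rw [uY, ← Complex.exp_nat_mul]
  push_cast
  rw [show (16 : ℂ) * -((π : ℂ) / 16 * I) = -((π : ℂ) * I) by ring, Complex.exp_neg, Complex.exp_pi_mul_I]
  norm_num

/-- `t = y⁵`. [cite: GlazmanManolescu2019, §2.1, eq. (2.1) (σ = 5/8)] -/
private theorem tFiveEighths_eq_uY_pow' : tFiveEighths = uY ^ 5 := by
  rw [tFiveEighths, uY, ← Complex.exp_nat_mul]; congr 1; push_cast; ring

/-- `r(π/3) · y⁷ = 1`. [cite: GlazmanManolescu2019, Lemma 2.1, eq. (CR)] -/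
private theorem ybRatio_pi_div_three_mul' : ybRatio (π / 3) * uY ^ 7 = 1 := by
  rw [ybRatio, uY, ← Complex.exp_nat_mul, ← Complex.exp_add,
    show (3 * (π / 3) / 8 + 5 * π / 16 : ℝ) = 7 * π / 16 by ring]
  convert Complex.exp_zero using 2
  push_cast
  ring

/-- `r(π/3) = −y⁹`. [folklore] -/
private theorem ybRatio_pi_div_three_eq' : ybRatio (π / 3) = -uY ^ 9 := by
  have h1 : uY ^ 7 * (-uY ^ 9) = 1 := by linear_combination (-1 : ℂ) * uY_pow_sixteen''
  calc ybRatio (π / 3) = ybRatio (π / 3) * (uY ^ 7 * (-uY ^ 9)) := by rw [h1, mul_one]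
    _ = ybRatio (π / 3) * uY ^ 7 * (-uY ^ 9) := by ring
    _ = -uY ^ 9 := by rw [ybRatio_pi_div_three_mul', one_mul]

/-- `x_c · (y² + y⁻²) = 1`. [cite: DuminilCopinSmirnov2012, §1 (x_c = 1/√(2+√2))] -/
private theorem hexCriticalFugacity_mul_uY' : (hexCriticalFugacity : ℂ) * (uY ^ 2 + (uY ^ 2)⁻¹) = 1 := by
  have hsq : uY ^ 2 = Complex.exp (-((π : ℂ) / 8) * I) := by
    rw [uY, ← Complex.exp_nat_mul]; congr 1; push_cast; ring
  have hinv : (uY ^ 2)⁻¹ = Complex.exp (((π : ℂ) / 8) * I) := by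
    rw [hsq, ← Complex.exp_neg]; congr 1; ring
  have hcos : Complex.cos ((π : ℂ) / 8) = (Real.cos (π / 8) : ℂ) := by
    rw [Complex.ofReal_cos]; push_cast; ring_nf
  have hsum : uY ^ 2 + (uY ^ 2)⁻¹ = (Real.sqrt (2 + Real.sqrt 2) : ℂ) := by
    rw [hinv, hsq, add_comm, ← Complex.two_cos, hcos, Real.cos_pi_div_eight]
    push_cast
    ring
  rw [hsum, hexCriticalFugacity]
  have h : (Real.sqrt (2 + Real.sqrt 2) : ℂ) ≠ 0 :=
    Complex.ofReal_ne_zero.2 (Real.sqrt_pos.2 (by positivity)).ne'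
  push_cast
  exact inv_mul_cancel₀ h

/-- `2 x_c = y² − y⁶ + y¹⁰ − y¹⁴`. [folklore] -/
private theorem two_mul_hexCriticalFugacity' :
    2 * (hexCriticalFugacity : ℂ) = uY ^ 2 - uY ^ 6 + uY ^ 10 - uY ^ 14 := by
  have hy := uY_ne_zero''
  have hx' : (hexCriticalFugacity : ℂ) * (uY ^ 4 + 1) = uY ^ 2 := by
    have h := hexCriticalFugacity_mul_uY'
    have hy2 : uY ^ 2 ≠ 0 := pow_ne_zero 2 hy
    calc (hexCriticalFugacity : ℂ) * (uY ^ 4 + 1)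
        = (hexCriticalFugacity : ℂ) * (uY ^ 2 + (uY ^ 2)⁻¹) * uY ^ 2 := by field_simp
      _ = uY ^ 2 := by rw [h, one_mul]
  linear_combination (1 - uY ^ 4 + uY ^ 8 - uY ^ 12) * hx' + (hexCriticalFugacity : ℂ) * uY_pow_sixteen''

/-! ### The defect at the interior face -/

/-- **The printed weights at `θ = π/3` violate the vertex relation at the INTERIOR face `(2,2)` for
the hole root**: `F·t⁷ = 2 x_c¹⁸ (y³ − y¹⁵)`. [cite: GlazmanManolescu2019, eq. (1), Lemma 2.1]
[cite: DuminilCopinSmirnov2012, Lemma 1] -/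
theorem vertexFunctional_printed_dom11 :
    vertexFunctional (printedWeights (π / 3)) tFiveEighths (ybCoeff (π / 3)) dom11 holeRootE (2, 2) *
        tFiveEighths ^ 7 = 2 * (hexCriticalFugacity : ℂ) ^ 18 * (uY ^ 3 - uY ^ 15) := by
  rw [vertexFunctional_dom11_mul _ tFiveEighths_ne_zero, printedWeights_pi_div_three', ← oddCoeff_ybRatio,
    tFiveEighths_eq_uY_pow', ybRatio_pi_div_three_eq']
  have c0 : oddCoeff (-uY ^ 9) 0 = 1 := rfl
  have c1 : oddCoeff (-uY ^ 9) 1 = -uY ^ 9 := rfl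
  have c2 : oddCoeff (-uY ^ 9) 2 = -1 := rfl
  have c3 : oddCoeff (-uY ^ 9) 3 = -(-uY ^ 9) := rfl
  simp only [c0, c1, c2, c3]
  have h16 := uY_pow_sixteen''
  have hx2 := two_mul_hexCriticalFugacity'
  set x : ℂ := (hexCriticalFugacity : ℂ) with hxdef
  set y : ℂ := uY with hydef
  linear_combination (((1 : ℂ) / 2) * x * y ^ 3 + ((-1 : ℂ) / 2) * x * y ^ 15 + ((1 : ℂ) / 2) * x ^ 2 * y + ((-1 : ℂ) / 2) * x ^ 2 * y ^ 13 + ((-1 : ℂ) / 2) * x ^ 5 * y ^ 11 + ((-1 : ℂ) / 2) * x ^ 5 * y ^ 15 + ((1 : ℂ) / 2) * x ^ 6 * y + ((-1 : ℂ) / 2) * x ^ 6 * y ^ 13 + ((-1 : ℂ) / 2) * x ^ 12 * y + ((1 : ℂ) / 2) * x ^ 12 * y ^ 13 + ((-1 : ℂ) / 2) * x ^ 13 * y ^ 3 + ((1 : ℂ) / 2) * x ^ 13 * y ^ 15 + ((-1 : ℂ) / 2) * x ^ 16 * y + ((1 : ℂ) / 2) * x ^ 16 * y ^ 13 + (-1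 : ℂ) * x ^ 17 * y ^ 3 + (1 : ℂ) * x ^ 17 * y ^ 15) * hx2 + (((1 : ℂ) / 2) * x * y ^ 5 + ((-1 : ℂ) / 2) * x * y ^ 9 + ((1 : ℂ) / 2) * x * y ^ 13 + (-1 : ℂ) * x * y ^ 17 + (1 : ℂ) * x * y ^ 33 + ((-1 : ℂ) / 2) * x ^ 2 * y ^ 3 + ((-1 : ℂ) / 2) * x ^ 2 * y ^ 7 + ((1 : ℂ) / 2) * x ^ 2 * y ^ 11 + (1 : ℂ) * x ^ 2 * y ^ 19 + (-1 : ℂ) * x ^ 3 * y + (1 : ℂ) * x ^ 3 * y ^ 13 + (1 : ℂ) * x ^ 3 * y ^ 17 + (-1 : ℂ) * x ^ 3 * y ^ 29 + (-1 : ℂ) * x ^ 3 * y ^ 33 + ((-1 : ℂ) / 2) * x ^ 5 * y ^ 13 + (1 : ℂ) * x ^ 5 * y ^ 29 + ((1 : ℂ) / 2) * x ^ 6 * y ^ 3 + ((-1 : ℂ) / 2) * x ^ 6 * y ^ 7 + ((3 : ℂ) / 2) * x ^ 6 * y ^ 11 + (-1 : ℂ) * x ^ 6 * y ^ 27 + (1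 : ℂ) * x ^ 6 * y ^ 43 + (-1 : ℂ) * x ^ 7 * y + (1 : ℂ) * x ^ 7 * y ^ 13 + (1 : ℂ) * x ^ 7 * y ^ 17 + (-1 : ℂ) * x ^ 7 * y ^ 29 + (-1 : ℂ) * x ^ 7 * y ^ 33 + ((-1 : ℂ) / 2) * x ^ 12 * y ^ 3 + ((1 : ℂ) / 2) * x ^ 12 * y ^ 7 + ((-1 : ℂ) / 2) * x ^ 12 * y ^ 11 + (1 : ℂ) * x ^ 13 * y + ((-1 : ℂ) / 2) * x ^ 13 * y ^ 5 + ((1 : ℂ) / 2) * x ^ 13 * y ^ 9 + ((-3 : ℂ) / 2) * x ^ 13 * y ^ 13 + (1 : ℂ) * x ^ 14 * y ^ 3 + ((-1 : ℂ) / 2) * x ^ 16 * y ^ 3 + ((1 : ℂ) / 2) * x ^ 16 * y ^ 7 + ((-1 : ℂ) / 2) * x ^ 16 * y ^ 11 + (1 : ℂ) * x ^ 17 * y + (-1 : ℂ) * x ^ 17 * y ^ 5 + (1 : ℂ) * x ^ 17 * y ^ 9 + (-2 : ℂ) * x ^ 17 * y ^ 13 + (1 : ℂ) * x ^ 17 *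 y ^ 17 + (-1 : ℂ) * x ^ 17 * y ^ 33 + (1 : ℂ) * x ^ 17 * y ^ 49) * h16

/-- **The defect is nonzero** (`x_c ≠ 0`, `y ≠ 0`, `y¹² ≠ 1`). [cite: GlazmanManolescu2019, Lemma 2.1] -/
theorem vertexFunctional_printed_dom11_ne_zero :
    vertexFunctional (printedWeights (π / 3)) tFiveEighths (ybCoeff (π / 3)) dom11 holeRootE (2, 2) ≠ 0 := by
  intro h
  have key := vertexFunctional_printed_dom11
  rw [h, zero_mul] at key
  have hx : (hexCriticalFugacity : ℂ) ≠ 0 := Complex.ofReal_ne_zero.2 hexCriticalFugacity_pos_lt_one.1.ne'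
  have hy : uY ≠ 0 := uY_ne_zero''
  have h16 := uY_pow_sixteen''
  have h12 : uY ^ 3 - uY ^ 15 ≠ 0 := by
    intro h0
    have h12' : uY ^ 12 = 1 := by
      have : uY ^ 3 * (1 - uY ^ 12) = 0 := by linear_combination h0
      have h1 := (mul_eq_zero.1 this).resolve_left (pow_ne_zero 3 hy)
      linear_combination -h1
    have : (uY ^ 16) ^ 3 = (uY ^ 12) ^ 4 := by ring
    rw [h16, h12'] at this
    norm_num at this
  exact (mul_ne_zero (mul_ne_zero (by norm_num) (pow_ne_zero 18 hx)) h12) key.symm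

/-- **Even the interior-faces class is violated by the printed Yang–Baxter weights**: at `θ = π/3`,
`ExactPlaquetteVertexRelationInt (W(θ)) t (1, r(θ), −1, −r(θ))` is false — the relation fails at an
INTERIOR face for a (non-isthmus) hole root. [cite: DuminilCopinSmirnov2012, Lemma 1 (interior vertices; Ω simply connected)]
[cite: GlazmanManolescu2019, Lemma 2.1] -/
theorem not_exactPlaquetteVertexRelationInt_printed_pi_div_three :
    ¬ ExactPlaquetteVertexRelationInt (printedWeights (π / 3)) tFiveEighths (ybCoeff (π / 3)) :=
  fun h => vertexFunctional_printed_dom11_ne_zero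
    (h dom11 holeRootE (2, 2) face22_mem_dom11 isInteriorFace_dom11 isBoundaryRoot_holeRootE)

/-- **The hole root of `dom11` is not an outer root** (through the observable, as in
`PlaquetteWalkHoleRootDefect`). [cite: GlazmanManolescu2019, Lemma 2.1] -/
theorem not_outerRoot_holeRootE : ¬ OuterRoot (dom dom11) holeRootE := fun hO =>
  vertexFunctional_printed_dom11_ne_zero
    (vertexFunctional_printed_eq_zero (θ := π / 3) ⟨le_rfl, by linarith [Real.pi_pos]⟩ dom11 holeRootE hO
      (2, 2) face22_mem_dom11)

/-! ### The curve's weights in factorised closed form -/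

section Factorised

variable {t r : ℂ}

/-- `t⁴ − 1 ≠ 0`. [folklore] -/
private theorem t4m1_ne (ht4 : t ^ 4 ≠ 1) : t ^ 4 - 1 ≠ 0 := fun h => ht4 (by linear_combination h)

/-- The denominator in `field_simp`'s preferred form. [folklore] -/
private theorem den_ne' (hD : t ^ 6 * (1 + r ^ 4) - (1 + t ^ 12) * r ^ 2 ≠ 0) :
    t ^ 6 * (1 + r ^ 4) - r ^ 2 * (1 + t ^ 12) ≠ 0 := fun h => hD (by linear_combination h)

/-- `u₁ = r t (1 − t⁸)(t² − r²)/Q` on the odd curve. [cite: Glazman2015WeightedSAW, Lemma 3.1, (3.3)–(3.7)] -/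
theorem ybCurve_u₁_eq (ht : t ≠ 0) (ht4 : t ^ 4 ≠ 1) (hr : r ≠ 0)
    (hD : t ^ 6 * (1 + r ^ 4) - (1 + t ^ 12) * r ^ 2 ≠ 0) :
    (ybCurve (-1) t r).u₁ = r * t * (1 - t ^ 8) * (t ^ 2 - r ^ 2) / (t ^ 6 * (1 + r ^ 4) - (1 + t ^ 12) * r ^ 2) := by
  have := t4m1_ne ht4; have := den_ne' hD
  simp only [ybCurve, ybU1, ybV]
  field_simp
  ring

/-- `u₂ = r t (1 − t⁸)(1 − t²r²)/Q` on the odd curve. [cite: Glazman2015WeightedSAW, Lemma 3.1, (3.3)–(3.7)] -/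
theorem ybCurve_u₂_eq (ht : t ≠ 0) (ht4 : t ^ 4 ≠ 1) (hr : r ≠ 0)
    (hD : t ^ 6 * (1 + r ^ 4) - (1 + t ^ 12) * r ^ 2 ≠ 0) :
    (ybCurve (-1) t r).u₂ = r * t * (1 - t ^ 8) * (1 - t ^ 2 * r ^ 2) / (t ^ 6 * (1 + r ^ 4) - (1 + t ^ 12) * r ^ 2) := by
  have := t4m1_ne ht4; have := den_ne' hD
  simp only [ybCurve, ybU1, ybU2, ybV]
  field_simp
  ring

/-- `v = t⁴ (t² − r²)(1 − t²r²)/Q` on the odd curve. [cite: Glazman2015WeightedSAW, Lemma 3.1, (3.3)–(3.7)] -/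
theorem ybCurve_v_eq (hD : t ^ 6 * (1 + r ^ 4) - (1 + t ^ 12) * r ^ 2 ≠ 0) :
    (ybCurve (-1) t r).v = t ^ 4 * (t ^ 2 - r ^ 2) * (1 - t ^ 2 * r ^ 2) / (t ^ 6 * (1 + r ^ 4) - (1 + t ^ 12) * r ^ 2) := by
  have := den_ne' hD
  simp only [ybCurve, ybV]
  field_simp
  ring

/-- `w₁ = (t² − r²)(1 − t¹⁰r²)/Q` on the odd curve. [cite: Glazman2015WeightedSAW, Lemma 3.1, (3.3)–(3.7)] -/
theorem ybCurve_w₁_eq (ht : t ≠ 0) (ht4 : t ^ 4 ≠ 1) (hr : r ≠ 0)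
    (hD : t ^ 6 * (1 + r ^ 4) - (1 + t ^ 12) * r ^ 2 ≠ 0) :
    (ybCurve (-1) t r).w₁ = (t ^ 2 - r ^ 2) * (1 - t ^ 10 * r ^ 2) / (t ^ 6 * (1 + r ^ 4) - (1 + t ^ 12) * r ^ 2) := by
  have := t4m1_ne ht4; have := den_ne' hD
  simp only [ybCurve, ybU1, ybV, ybW1]
  field_simp
  ring

/-- `w₂ = (1 − t²r²)(t¹⁰ − r²)/Q` on the odd curve. [cite: Glazman2015WeightedSAW, Lemma 3.1, (3.3)–(3.7)] -/
theorem ybCurve_w₂_eq (ht : t ≠ 0) (ht4 : t ^ 4 ≠ 1) (hr : r ≠ 0)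
    (hD : t ^ 6 * (1 + r ^ 4) - (1 + t ^ 12) * r ^ 2 ≠ 0) :
    (ybCurve (-1) t r).w₂ = (1 - t ^ 2 * r ^ 2) * (t ^ 10 - r ^ 2) / (t ^ 6 * (1 + r ^ 4) - (1 + t ^ 12) * r ^ 2) := by
  have := t4m1_ne ht4; have := den_ne' hD
  simp only [ybCurve, ybU1, ybU2, ybV, ybW2]
  field_simp
  ring

end Factorised

/-! ### The interior defect on the whole curve: `F_(2,2) = 2 r t · u₁³ u₂² v⁴ w₁` -/

/-- **The interior-face functional of `dom11` on the odd curve**: with `c = (1, r, −1, −r)`,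
`F_(2,2) · t⁷ = 2 r t⁸ · u₁³ u₂² v⁴ w₁` — the nineteen terms collapse (polynomial identity in the
factorised closed forms). [cite: GlazmanManolescu2019, §2.1, eq. (2.1)] -/
theorem vertexFunctional_dom11_ybCurve {t r : ℂ} (ht : t ≠ 0) (ht4 : t ^ 4 ≠ 1) (hr : r ≠ 0)
    (hD : t ^ 6 * (1 + r ^ 4) - (1 + t ^ 12) * r ^ 2 ≠ 0) :
    vertexFunctional (ybCurve (-1) t r) t (oddCoeff r) dom11 holeRootE (2, 2) * t ^ 7 =
      2 * r * t ^ 8 * (ybCurve (-1) t r).u₁ ^ 3 * (ybCurve (-1) t r).u₂ ^ 2 * (ybCurve (-1) t r).v ^ 4 *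
        (ybCurve (-1) t r).w₁ := by
  rw [vertexFunctional_dom11_mul _ ht]
  have c0 : oddCoeff r 0 = 1 := rfl
  have c1 : oddCoeff r 1 = r := rfl
  have c2 : oddCoeff r 2 = -1 := rfl
  have c3 : oddCoeff r 3 = -r := rfl
  simp only [c0, c1, c2, c3]
  rw [ybCurve_u₁_eq ht ht4 hr hD, ybCurve_u₂_eq ht ht4 hr hD, ybCurve_v_eq hD, ybCurve_w₁_eq ht ht4 hr hD,
    ybCurve_w₂_eq ht ht4 hr hD]
  have := den_ne' hD
  field_simp
  ring

/-! ### The mirrored domain: the same defect with `w₂` in place of `w₁` -/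

/-- `dom11m`: the reflection of `dom11` in the horizontal axis of the hole (corner and co-corner
arcs exchanged): the ring plus `(3,1)`, `(3,0)`, `(2,−1)`, interior face `(2,0)`. [folklore] -/
def dom11m : List Face :=
  [(0, 0), (1, 0), (2, 0), (0, 1), (2, 1), (0, 2), (1, 2), (2, 2), (3, 0), (2, -1), (3, 1)]

/-- The hole root is a boundary root of `dom11m`. [cite: GlazmanManolescu2019, §2.1 (walks start on the boundary)] -/
theorem isBoundaryRoot_holeRootE_m : IsBoundaryRoot dom11m holeRootE := by
  decide

/-- `(2,0)` is an interior face of `dom11m`. [cite: DuminilCopinSmirnov2012, Lemma 1 ("for every vertex v ∈ V(Ω)")] -/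
theorem isInteriorFace_dom11m : IsInteriorFace dom11m (2, 0) := by
  decide

/-- `(2,0) ∈ dom11m`. [folklore] -/
private theorem face20_mem_dom11m : ((2 : ℤ), (0 : ℤ)) ∈ dom11m := by
  decide

set_option maxRecDepth 100000 in
/-- Kernel enumeration: the nineteen walks of `dom11m` from the hole root ending on a side of `(2,0)`.
[folklore] -/
private theorem termsN_dom11m :
    termsN dom11m holeRootE (2, 0) (depth dom11m) 7 =
      [⟨1, 0, 1, 0, 0, 0, 6⟩, ⟨2, 1, 1, 0, 0, 0, 5⟩, ⟨0, 3, 3, 3, 0, 1, 1⟩, ⟨3, 2, 3, 3, 1, 1, 2⟩, ⟨0, 0, 2, 0, 0, 0, 7⟩, ⟨2, 2, 4, 3, 0, 1, 11⟩, ⟨3, 2, 3, 3, 0, 2, 10⟩, ⟨3, 0, 1, 1, 0, 0, 6⟩, ⟨2, 2, 2, 3, 0, 0, 11⟩, ⟨1, 3, 2, 3, 0, 0, 12⟩, ⟨0, 3, 3, 3, 1, 0, 9⟩, ⟨3, 2, 3, 3, 2, 0, 10⟩, ⟨0, 2, 2, 4, 0, 0, 11⟩, ⟨1, 2, 3, 4,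 1, 0, 14⟩, ⟨3, 2, 3, 3, 0, 0, 10⟩, ⟨0, 1, 1, 1, 0, 0, 5⟩, ⟨2, 1, 1, 2, 0, 0, 5⟩, ⟨1, 1, 2, 1, 0, 0, 4⟩, ⟨3, 2, 1, 1, 0, 0, 6⟩] := by
  decide
set_option maxHeartbeats 400000 in -- buildfix (bf3-g31): 160k/180k FAIL, 200k PASS at accept time; line-neutral budget line
set_option maxRecDepth 100000 in
/-- The vertex functional at the interior face `(2,0)` of `dom11m` for the hole root, arbitrary weights
(`F·t⁷` as the nineteen-term row). [cite: GlazmanManolescu2019, §2.1, eq. (2.1)] -/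
theorem vertexFunctional_dom11m_mul (W : CWeights) {t : ℂ} (ht : t ≠ 0) (c : Fin 4 → ℂ) :
    vertexFunctional W t c dom11m holeRootE (2, 0) * t ^ 7 =
      c 1 * W.u₂ * t ^ 6 +
      c 2 * W.u₁ * W.u₂ * t ^ 5 +
      c 0 * W.u₁ ^ 3 * W.u₂ ^ 3 * W.v ^ 3 * W.w₂ * t +
      c 3 * W.u₁ ^ 2 * W.u₂ ^ 3 * W.v ^ 3 * W.w₁ * W.w₂ * t ^ 2 +
      c 0 * W.u₂ ^ 2 * t ^ 7 +
      c 2 * W.u₁ ^ 2 * W.u₂ ^ 4 * W.v ^ 3 * W.w₂ * t ^ 11 +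
      c 3 * W.u₁ ^ 2 * W.u₂ ^ 3 * W.v ^ 3 * W.w₂ ^ 2 * t ^ 10 +
      c 3 * W.u₂ * W.v * t ^ 6 +
      c 2 * W.u₁ ^ 2 * W.u₂ ^ 2 * W.v ^ 3 * t ^ 11 +
      c 1 * W.u₁ ^ 3 * W.u₂ ^ 2 * W.v ^ 3 * t ^ 12 +
      c 0 * W.u₁ ^ 3 * W.u₂ ^ 3 * W.v ^ 3 * W.w₁ * t ^ 9 +
      c 3 * W.u₁ ^ 2 * W.u₂ ^ 3 * W.v ^ 3 * W.w₁ ^ 2 * t ^ 10 +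
      c 0 * W.u₁ ^ 2 * W.u₂ ^ 2 * W.v ^ 4 * t ^ 11 +
      c 1 * W.u₁ ^ 2 * W.u₂ ^ 3 * W.v ^ 4 * W.w₁ * t ^ 14 +
      c 3 * W.u₁ ^ 2 * W.u₂ ^ 3 * W.v ^ 3 * t ^ 10 +
      c 0 * W.u₁ * W.u₂ * W.v * t ^ 5 +
      c 2 * W.u₁ * W.u₂ * W.v ^ 2 * t ^ 5 +
      c 1 * W.u₁ * W.u₂ ^ 2 * W.v * t ^ 4 +
      c 3 * W.u₁ ^ 2 * W.u₂ * W.v * t ^ 6 := by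
  have hrow := vertexFunctional_mul_pow_eq_rowSumN W ht c dom11m holeRootE (2, 0) 7 (by decide)
  rw [termsN_dom11m] at hrow
  rw [hrow]
  simp only [rowSumN, List.map_cons, List.map_nil, List.sum_cons, List.sum_nil, CWeights.mono, pow_zero,
    pow_one, mul_one]
  ring

/-- **The interior-face functional of `dom11m` on the odd curve**: `F_(2,0) · t⁷ = −2 r t⁶ · u₁² u₂³ v⁴ w₂`.
[cite: GlazmanManolescu2019, §2.1, eq. (2.1)] -/
theorem vertexFunctional_dom11m_ybCurve {t r : ℂ} (ht : t ≠ 0) (ht4 : t ^ 4 ≠ 1) (hr : r ≠ 0)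
    (hD : t ^ 6 * (1 + r ^ 4) - (1 + t ^ 12) * r ^ 2 ≠ 0) :
    vertexFunctional (ybCurve (-1) t r) t (oddCoeff r) dom11m holeRootE (2, 0) * t ^ 7 =
      -2 * r * t ^ 6 * (ybCurve (-1) t r).u₁ ^ 2 * (ybCurve (-1) t r).u₂ ^ 3 * (ybCurve (-1) t r).v ^ 4 *
        (ybCurve (-1) t r).w₂ := by
  rw [vertexFunctional_dom11m_mul _ ht]
  have c0 : oddCoeff r 0 = 1 := rfl
  have c1 : oddCoeff r 1 = r := rfl
  have c2 : oddCoeff r 2 = -1 := rfl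
  have c3 : oddCoeff r 3 = -r := rfl
  simp only [c0, c1, c2, c3]
  rw [ybCurve_u₁_eq ht ht4 hr hD, ybCurve_u₂_eq ht ht4 hr hD, ybCurve_v_eq hD, ybCurve_w₁_eq ht ht4 hr hD,
    ybCurve_w₂_eq ht ht4 hr hD]
  have := den_ne' hD
  field_simp
  ring

/-! ### Rigidity from the interior-faces class (the tree's private chain, re-assembled) -/

open private formsInt forms_adjInt inst_JE inst_JN inst_JW inst_JS rigidity_of_forms
  from Literature.Barriers.CriticalPhenomena.PlaquetteWalkSpinRigidity
open private no_two_components from Literature.Barriers.CriticalPhenomena.PlaquetteWalkYBCoefficientRigidity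
open private msign_mul_self from Literature.Barriers.CriticalPhenomena.PlaquetteWalkSignGauge

section IntRigidity

variable {W : CWeights} {t : ℂ} {c : Fin 4 → ℂ}

/-- `t¹⁶ = −1 ⇒ t⁴ ≠ 1`. [folklore] -/
private theorem pow_four_ne_one'' (h : t ^ 16 = -1) : t ^ 4 ≠ 1 := by
  intro h4
  have : t ^ 16 = 1 := by
    calc t ^ 16 = (t ^ 4) ^ 4 := by ring
      _ = 1 := by rw [h4]; norm_num
  rw [h] at this; norm_num at this

/-- **Coefficient parity from the INTERIOR-faces class**: the coefficient vector of an interior-faces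
relation with `u₁u₂v ≠ 0` is `ρ²`-odd or `ρ²`-even (F5's argument on the tree's interior instances).
[cite: Glazman2015WeightedSAW, Lemma 3.1, Appendix («the solution is unique»)] -/
theorem coeff_eigenvector_of_exactPlaquetteVertexRelationInt (hrel : ExactPlaquetteVertexRelationInt W t c)
    (ht : t ≠ 0) (h1 : W.u₁ ≠ 0) (h2 : W.u₂ ≠ 0) (hv : W.v ≠ 0) :
    (c 0 + c 2 = 0 ∧ c 1 + c 3 = 0) ∨ (c 0 - c 2 = 0 ∧ c 1 - c 3 = 0) := by
  by_contra H
  have habp : c 0 + 1 * c 2 ≠ 0 ∨ c 1 + 1 * c 3 ≠ 0 := by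
    by_contra h'
    push Not at h'
    exact H (Or.inl ⟨by linear_combination h'.1, by linear_combination h'.2⟩)
  have habm : c 0 + (-1) * c 2 ≠ 0 ∨ c 1 + (-1) * c 3 ≠ 0 := by
    by_contra h'
    push Not at h'
    exact H (Or.inr ⟨by linear_combination h'.1, by linear_combination h'.2⟩)
  have hc : c ≠ 0 := by
    rintro rfl
    simp at habp
  have h16 := t_pow_sixteen_of_exactPlaquetteVertexRelationInt hrel ht h1 h2 hv hc
  obtain ⟨fA1, fA1', fB1, fB1', -, -⟩ := formsInt hrel ht h1 h2 hv
  obtain ⟨fC1, fC1', fE1, fE1'⟩ := forms_adjInt hrel ht h1 h2 hv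
  obtain ⟨ha, hb, -, -, hR4p, hR3p, hR2p, hR1p⟩ := rigidity_of_forms ht h2 h16 (inst_JE hrel ht hv)
    (inst_JN hrel ht hv) (inst_JW hrel ht hv) (inst_JS hrel ht hv) fA1 fA1' fB1 fB1' fC1 fC1' fE1 fE1'
    (Or.inl rfl) habp
  obtain ⟨ha', hb', -, -, hR4m, hR3m, hR2m, hR1m⟩ := rigidity_of_forms ht h2 h16 (inst_JE hrel ht hv)
    (inst_JN hrel ht hv) (inst_JW hrel ht hv) (inst_JS hrel ht hv) fA1 fA1' fB1 fB1' fC1 fC1' fE1 fE1'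
    (Or.inr rfl) habm
  exact no_two_components (u₂ := W.u₂) (w₁ := W.w₁) (w₂ := W.w₂) ht h16 h1 hv ha hb ha' hb'
    (by linear_combination hR4p)
    (by linear_combination hR3p) (by linear_combination hR2p) (by linear_combination hR1p)
    (by linear_combination hR4m) (by linear_combination hR3m) (by linear_combination hR2m)
    (by linear_combination hR1m)

/-- **Pair rigidity from the INTERIOR-faces class**: `W = ybCurve ε t r` and `c = c_E·(1, r, ε, εr)`.
[cite: Glazman2015WeightedSAW, Lemma 3.1, Appendix («the solution is unique»)] -/
theorem pair_rigidityInt (hrel : ExactPlaquetteVertexRelationInt W t c) (ht : t ≠ 0) (h1 : W.u₁ ≠ 0)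
    (h2 : W.u₂ ≠ 0) (hv : W.v ≠ 0) (hc : c ≠ 0) :
    ∃ ε r : ℂ, (ε = 1 ∨ ε = -1) ∧ W = ybCurve ε t r ∧ c 0 ≠ 0 ∧ c = fun i => c 0 * epsCoeff ε r i := by
  obtain ⟨ε, hε, ha, hW⟩ := weights_eq_ybCurveInt hrel ht h1 h2 hv hc
  have hpar := coeff_eigenvector_of_exactPlaquetteVertexRelationInt hrel ht h1 h2 hv
  have key : c 2 = ε * c 0 ∧ c 3 = ε * c 1 := by
    rcases hε with rfl | rfl <;> rcases hpar with ⟨h0, h1'⟩ | ⟨h0, h1'⟩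
    · exact absurd (by linear_combination h0) ha
    · exact ⟨by linear_combination -h0, by linear_combination -h1'⟩
    · exact ⟨by linear_combination h0, by linear_combination h1'⟩
    · exact absurd (by linear_combination h0) ha
  have hc0 : c 0 ≠ 0 := by
    intro h0
    apply ha
    rw [key.1, h0]
    ring
  have hratio : (c 1 + ε * c 3) / (c 0 + ε * c 2) = c 1 / c 0 := by
    rw [div_eq_div_iff ha hc0, key.1, key.2]
    ring
  refine ⟨ε, c 1 / c 0, hε, ?_, hc0, ?_⟩
  · rw [hW, hratio]
  · funext i
    fin_cases i
    · simp [epsCoeff]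
    · simp only [epsCoeff]
      show c 1 = c 0 * (c 1 / c 0)
      field_simp
    · simp only [epsCoeff]
      show c 2 = c 0 * ε
      rw [key.1]; ring
    · simp only [epsCoeff]
      show c 3 = c 0 * (ε * (c 1 / c 0))
      rw [key.2]; field_simp

end IntRigidity

/-! ### The interior-faces class is EMPTY on the five-weight family with `u₁u₂v ≠ 0` -/

/-- Scaling the coefficient vector scales the functional. [folklore] -/
private theorem vertexFunctional_smul (W : CWeights) (t k : ℂ) (c : Fin 4 → ℂ) (Dl : List Face)
    (a : MidEdge) (f₀ : Face) :
    vertexFunctional W t (fun i => k * c i) Dl a f₀ = k * vertexFunctional W t c Dl a f₀ := by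
  unfold vertexFunctional
  rw [Finset.mul_sum]
  refine Finset.sum_congr rfl fun s _ => ?_
  ring

/-- Negating the coefficient vector negates the functional. [folklore] -/
private theorem vertexFunctional_neg_coeff (W : CWeights) (t : ℂ) (c : Fin 4 → ℂ) (Dl : List Face)
    (a : MidEdge) (f₀ : Face) :
    vertexFunctional W t (-c) Dl a f₀ = -vertexFunctional W t c Dl a f₀ := by
  rw [show (-c) = fun i => (-1) * c i from funext fun i => by simp, vertexFunctional_smul]
  ring

/-- The core contradiction: on the odd curve (`u₁u₂v ≠ 0` there), the two interior instances force
`w₁ = 0` AND `w₂ = 0`, which the closed forms forbid at an admissible spin. [folklore] -/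
private theorem core_contra {t r : ℂ} (h16 : t ^ 16 = -1) (hr : r ≠ 0)
    (hD : t ^ 6 * (1 + r ^ 4) - (1 + t ^ 12) * r ^ 2 ≠ 0)
    (hu1 : (ybCurve (-1) t r).u₁ ≠ 0) (hu2 : (ybCurve (-1) t r).u₂ ≠ 0) (hv : (ybCurve (-1) t r).v ≠ 0)
    (hA : vertexFunctional (ybCurve (-1) t r) t (oddCoeff r) dom11 holeRootE (2, 2) = 0)
    (hB : vertexFunctional (ybCurve (-1) t r) t (oddCoeff r) dom11m holeRootE (2, 0) = 0) : False := by
  have ht : t ≠ 0 := by rintro rfl; norm_num at h16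
  have ht4 := pow_four_ne_one'' h16
  set W := ybCurve (-1) t r with hWdef
  -- w₁ = 0 from dom11, w₂ = 0 from dom11m
  have hA7 := vertexFunctional_dom11_ybCurve ht ht4 hr hD
  rw [hA, zero_mul] at hA7
  have hw1 : W.w₁ = 0 := by
    have h := hA7.symm
    have hne : 2 * r * t ^ 8 * W.u₁ ^ 3 * W.u₂ ^ 2 * W.v ^ 4 ≠ 0 :=
      mul_ne_zero (mul_ne_zero (mul_ne_zero (mul_ne_zero (mul_ne_zero two_ne_zero hr) (pow_ne_zero 8 ht))
        (pow_ne_zero 3 hu1)) (pow_ne_zero 2 hu2)) (pow_ne_zero 4 hv)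
    exact (mul_eq_zero.1 h).resolve_left hne
  have hB7 := vertexFunctional_dom11m_ybCurve ht ht4 hr hD
  rw [hB, zero_mul] at hB7
  have hw2 : W.w₂ = 0 := by
    have h := hB7.symm
    have hne : -2 * r * t ^ 6 * W.u₁ ^ 2 * W.u₂ ^ 3 * W.v ^ 4 ≠ 0 :=
      mul_ne_zero (mul_ne_zero (mul_ne_zero (mul_ne_zero (mul_ne_zero (by norm_num) hr) (pow_ne_zero 6 ht))
        (pow_ne_zero 2 hu1)) (pow_ne_zero 3 hu2)) (pow_ne_zero 4 hv)
    exact (mul_eq_zero.1 h).resolve_left hne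
  -- read the closed forms
  have hQ := hD
  rw [hWdef, ybCurve_w₁_eq ht ht4 hr hD, div_eq_zero_iff] at hw1
  rw [hWdef, ybCurve_w₂_eq ht ht4 hr hD, div_eq_zero_iff] at hw2
  rw [hWdef, ybCurve_u₁_eq ht ht4 hr hD] at hu1
  rw [hWdef, ybCurve_u₂_eq ht ht4 hr hD] at hu2
  have e1 : (t ^ 2 - r ^ 2) * (1 - t ^ 10 * r ^ 2) = 0 := hw1.resolve_right hQ
  have e2 : (1 - t ^ 2 * r ^ 2) * (t ^ 10 - r ^ 2) = 0 := hw2.resolve_right hQ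
  have n1 : t ^ 2 - r ^ 2 ≠ 0 := by
    intro h0; apply hu1; rw [h0]; simp
  have n2 : 1 - t ^ 2 * r ^ 2 ≠ 0 := by
    intro h0; apply hu2; rw [h0]; simp
  have f1 : 1 - t ^ 10 * r ^ 2 = 0 := (mul_eq_zero.1 e1).resolve_left n1
  have f2 : t ^ 10 - r ^ 2 = 0 := (mul_eq_zero.1 e2).resolve_left n2
  have h20 : t ^ 20 = 1 := by linear_combination (-1 : ℂ) * f1 + t ^ 10 * f2
  have h4 : t ^ 4 = -1 := by linear_combination -h20 + t ^ 4 * h16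
  have : t ^ 16 = 1 := by
    calc t ^ 16 = (t ^ 4) ^ 4 := by ring
      _ = 1 := by rw [h4]; norm_num
  rw [h16] at this
  norm_num at this

/-- **The interior-faces class is EMPTY on the five-weight family with `u₁u₂v ≠ 0`**: no complex
plaquette weights with nonzero corner, co-corner and straight weights, at any phase `t ≠ 0`, satisfy
an exact vertex relation with a nonzero coefficient vector at every INTERIOR face of every finite face
list for every boundary root (holes included) — Duminil-Copin–Smirnov's own quantifier. Proof: Int
rigidity puts `(W, c)` on a curve; the two interior instances `dom11`, `dom11m` read
`2 r t u₁³u₂²v⁴w₁ = 0` and `−2 r t⁻¹ u₁²u₂³v⁴w₂ = 0`, i.e. `w₁ = w₂ = 0`, impossible on the curve at an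
admissible spin (`w₁ = 0 ⇒ t¹⁰r² = 1`, `w₂ = 0 ⇒ r² = t¹⁰`, so `t²⁰ = 1`, contradicting `t¹⁶ = −1`).
[cite: DuminilCopinSmirnov2012, Lemma 1 (interior vertices; Ω simply connected, a ∈ ∂Ω)]
[cite: GlazmanManolescu2019, Lemma 2.1] [cite: Glazman2015WeightedSAW, Lemma 3.1] -/
theorem not_exactPlaquetteVertexRelationInt_of_ne_zero {W : CWeights} {t : ℂ} {c : Fin 4 → ℂ}
    (ht : t ≠ 0) (h1 : W.u₁ ≠ 0) (h2 : W.u₂ ≠ 0) (hv : W.v ≠ 0) (hc : c ≠ 0) :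
    ¬ ExactPlaquetteVertexRelationInt W t c := by
  intro hrel
  have h16 := t_pow_sixteen_of_exactPlaquetteVertexRelationInt hrel ht h1 h2 hv hc
  obtain ⟨ε, r, hε, hW, hc0, hcf⟩ := pair_rigidityInt hrel ht h1 h2 hv hc
  have hA := hrel dom11 holeRootE (2, 2) face22_mem_dom11 isInteriorFace_dom11 isBoundaryRoot_holeRootE
  have hB := hrel dom11m holeRootE (2, 0) face20_mem_dom11m isInteriorFace_dom11m isBoundaryRoot_holeRootE_m
  rw [hcf, vertexFunctional_smul] at hA hB
  replace hA := (mul_eq_zero.1 hA).resolve_left hc0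
  replace hB := (mul_eq_zero.1 hB).resolve_left hc0
  -- side conditions read off the closed forms
  have hr : r ≠ 0 := by
    rintro rfl; apply h1; rw [hW]; simp [ybCurve, ybU1]
  have hD : t ^ 6 * (1 + r ^ 4) - (1 + t ^ 12) * r ^ 2 ≠ 0 := by
    intro h; apply hv; rw [hW]; show ybV ε t r = 0; rw [ybV, h, div_zero]
  rcases hε with rfl | rfl
  · -- even component: pass through the sign gauge to the odd curve point
    rw [hW, ybCurve_one_eq_gauge] at hA hB h1 h2 hv
    rw [epsCoeff_one, vertexFunctional_neg_coeff, neg_eq_zero, signGauge, vertexFunctional_gauge] at hA hB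
    simp only [signGauge, ne_eq, neg_eq_zero] at h1 h2 hv
    have hunit : ∀ f₀ : Face, ((msign holeRootE * ((f₀.1 + f₀.2).negOnePow : ℤ) : ℤ) : ℂ) ≠ 0 := by
      intro f₀
      have hm : msign holeRootE ≠ 0 := fun h0 => by
        have := msign_mul_self holeRootE; rw [h0, mul_zero] at this; exact zero_ne_one this
      exact_mod_cast mul_ne_zero hm (Units.ne_zero _)
    replace hA := (mul_eq_zero.1 hA).resolve_left (hunit _)
    replace hB := (mul_eq_zero.1 hB).resolve_left (hunit _)
    exact core_contra h16 hr hD h1 h2 hv hA hB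
  · rw [hW] at hA hB h1 h2 hv
    rw [epsCoeff_neg_one] at hA hB
    exact core_contra h16 hr hD h1 h2 hv hA hB

/-- **Barrier `PlaquetteWalkNoInteriorRootsRelation`** (named statement): the interior-faces technique
class `ExactPlaquetteVertexRelationInt` is EMPTY on the five-weight family with `u₁u₂v ≠ 0` (any phase,
any nonzero coefficient vector). A THEOREM of this file (`PlaquetteWalkNoInteriorRootsRelation_holds`).

BARRIER (structured block, D-0021):
- technique_class: plaquette-local linear vertex relations `Σ_s c_s F(z_s) = 0` with a constant coefficient vector `c ∈ ℂ⁴ ∖ {0}` for the Glazman–Manolescu plaquette walk on `ℤ²` (complex weights, `u₁u₂v ≠ 0`, phase `t ≠ 0`), demanded at every INTERIOR face (four neighbours in the list) of every finite face list for EVERY boundary root — hole roots included: the predicate `ExactPlaquetteVertexRelationInt W t c` of `PlaquetteWalkSpinRigidity` (Duminil-Copin–Smirnov's quantifier)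
- blocks: an exact all-boundary-roots vertex identity in Duminil-Copin–Smirnov's interior form for any such weights; nothing is said about OUTER roots (there the identity holds on every finite face list on the sixteen curves: `PlaquetteWalkYBCurveIdentityAllSpins`) nor about isthmus hole roots away from the root plaquette (`PlaquetteWalkIsthmusRoot`)
- because: Int rigidity (`pair_rigidityInt`: `t¹⁶ = −1`, `W = ybCurve ε t r`, `c = c_E(1, r, ε, εr)`) and two kernel-enumerated interior instances at non-isthmus hole roots, `dom11` (`F_(2,2) = 2 r t u₁³u₂²v⁴w₁`) and its mirror `dom11m` (`F_(2,0) = −2 r t⁻¹ u₁²u₂³v⁴w₂`), force `w₁ = w₂ = 0`, impossible on the curve at an admissible spin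
- evasions_known: outer roots / hole-free or row-convex face lists (print's hypothesis «Ω simply connected, a ∈ ∂Ω» [cite: DuminilCopinSmirnov2012, §2 and proof of Lemma 1 (arXiv p. 4)]); root-dependent correction terms at hole roots
- scope_caveats: the branches `u₁ = 0` / `u₂ = 0` / `v = 0` are excluded (Glazman's degenerate family `σ = 1` lives at `v = 0` [cite: Glazman2015WeightedSAW, Lemma 3.1 (case σ = 1, p. 6)]); EXACT identities with constant coefficients only
- status: established — `PlaquetteWalkNoInteriorRootsRelation_holds` (this file); in print the relation is stated only for simply connected domains [cite: DuminilCopinSmirnov2012, Lemma 1] [cite: GlazmanManolescu2019, Lemma 2.1] (negative classification inside the typed class; venture lane label pending)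
[cite: DuminilCopinSmirnov2012, Lemma 1] [cite: GlazmanManolescu2019, Lemma 2.1] -/
def _root_.Literature.Barriers.CriticalPhenomena.PlaquetteWalkNoInteriorRootsRelation : Prop :=
  ∀ (W : CWeights) (t : ℂ) (c : Fin 4 → ℂ), t ≠ 0 → W.u₁ ≠ 0 → W.u₂ ≠ 0 → W.v ≠ 0 → c ≠ 0 →
    ¬ ExactPlaquetteVertexRelationInt W t c

/-- **`PlaquetteWalkNoInteriorRootsRelation` holds.** [cite: DuminilCopinSmirnov2012, Lemma 1] -/
theorem _root_.Literature.Barriers.CriticalPhenomena.PlaquetteWalkNoInteriorRootsRelation_holds :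
    PlaquetteWalkNoInteriorRootsRelation :=
  fun _ _ _ ht h1 h2 hv hc => not_exactPlaquetteVertexRelationInt_of_ne_zero ht h1 h2 hv hc

/-! ### Corollary: no point of an admissible curve is touch-free — the uniform SAW in the row-convex class -/

/-- **On an admissible curve, `w₁` and `w₂` do not both vanish** (given `u₁u₂v ≠ 0` at the point):
from the factorised closed forms, `w₁ = 0` forces `t¹⁰r² = 1` and `w₂ = 0` forces `r² = t¹⁰`, so
`t²⁰ = 1`, contradicting `t¹⁶ = −1`. [cite: Glazman2015WeightedSAW, Lemma 3.1 (the weights (3.3)–(3.7): w₁, w₂ ≠ 0 generically)] -/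
theorem ybCurve_not_noTouch {ε t r : ℂ} (hε : ε = 1 ∨ ε = -1) (h16 : t ^ 16 = -1)
    (h1 : (ybCurve ε t r).u₁ ≠ 0) (h2 : (ybCurve ε t r).u₂ ≠ 0) (hv : (ybCurve ε t r).v ≠ 0)
    (hw1 : (ybCurve ε t r).w₁ = 0) (hw2 : (ybCurve ε t r).w₂ = 0) : False := by
  have ht : t ≠ 0 := by rintro rfl; norm_num at h16
  have ht4 := pow_four_ne_one'' h16
  have hr : r ≠ 0 := by rintro rfl; apply h1; simp [ybCurve, ybU1]
  have hD : t ^ 6 * (1 + r ^ 4) - (1 + t ^ 12) * r ^ 2 ≠ 0 := by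
    intro h; apply hv; show ybV ε t r = 0; rw [ybV, h, div_zero]
  -- reduce to the odd point through the sign gauge (which fixes `u₂, w₁, w₂` and negates `u₁, v`)
  have key : (ybCurve (-1) t r).u₁ ≠ 0 ∧ (ybCurve (-1) t r).u₂ ≠ 0 ∧
      (ybCurve (-1) t r).w₁ = 0 ∧ (ybCurve (-1) t r).w₂ = 0 := by
    rcases hε with rfl | rfl
    · rw [ybCurve_one_eq_gauge] at h1 h2 hw1 hw2
      simp only [signGauge, ne_eq, neg_eq_zero] at h1 h2 hw1 hw2
      exact ⟨h1, h2, hw1, hw2⟩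
    · exact ⟨h1, h2, hw1, hw2⟩
  obtain ⟨hu1, hu2, e1, e2⟩ := key
  rw [ybCurve_w₁_eq ht ht4 hr hD, div_eq_zero_iff] at e1
  rw [ybCurve_w₂_eq ht ht4 hr hD, div_eq_zero_iff] at e2
  rw [ybCurve_u₁_eq ht ht4 hr hD] at hu1
  rw [ybCurve_u₂_eq ht ht4 hr hD] at hu2
  have n1 : t ^ 2 - r ^ 2 ≠ 0 := by intro h0; apply hu1; rw [h0]; simp
  have n2 : 1 - t ^ 2 * r ^ 2 ≠ 0 := by intro h0; apply hu2; rw [h0]; simp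
  have f1 : 1 - t ^ 10 * r ^ 2 = 0 := (mul_eq_zero.1 (e1.resolve_right hD)).resolve_left n1
  have f2 : t ^ 10 - r ^ 2 = 0 := (mul_eq_zero.1 (e2.resolve_right hD)).resolve_left n2
  have h20 : t ^ 20 = 1 := by linear_combination (-1 : ℂ) * f1 + t ^ 10 * f2
  have h4 : t ^ 4 = -1 := by linear_combination -h20 + t ^ 4 * h16
  have : t ^ 16 = 1 := by
    calc t ^ 16 = (t ^ 4) ^ 4 := by ring
      _ = 1 := by rw [h4]; norm_num
  rw [h16] at this
  norm_num at this

/-- **No-touch no-go in the ROW-CONVEX class** (the class in which the Yang–Baxter identities live): a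
weight system with `u₁u₂v ≠ 0` and NO self-touching (`w₁ = w₂ = 0`) carries no exact vertex relation
with a nonzero coefficient vector even on row-convex face lists, at any phase `t ≠ 0` — by the tree's
row-convex rigidity (`weights_eq_ybCurveRC`, spin rigidity) it would lie on an admissible curve, whose
points are never touch-free.
(The tree's `PlaquetteWalkNoTouchNoGo` states this for the all-boundary-roots class, now empty.)
[cite: BeatonGuttmannJensen2012, p. 2 ("there is no known appropriate parafermionic observable satisfying an identity like (1)")]
[cite: Glazman2015WeightedSAW, Lemma 3.1] -/
theorem not_exactPlaquetteVertexRelationRC_noTouch {W : CWeights} {t : ℂ} {c : Fin 4 → ℂ}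
    (ht : t ≠ 0) (h1 : W.u₁ ≠ 0) (h2 : W.u₂ ≠ 0) (hv : W.v ≠ 0) (hw1 : W.w₁ = 0) (hw2 : W.w₂ = 0)
    (hc : c ≠ 0) : ¬ ExactPlaquetteVertexRelationRC W t c := by
  intro hrel
  have h16 := t_pow_sixteen_of_exactPlaquetteVertexRelationRC hrel ht h1 h2 hv hc
  obtain ⟨ε, hε, -, hW⟩ := weights_eq_ybCurveRC hrel ht h1 h2 hv hc
  rw [hW] at h1 h2 hv hw1 hw2
  exact ybCurve_not_noTouch hε h16 h1 h2 hv hw1 hw2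

/-- **The uniform self-avoiding walk, any complex fugacity, any phase, in the row-convex class**: the
plaquette weights `(x, x, x, 0, 0)`, `x ≠ 0`, admit no exact vertex relation with `c ≠ 0` on row-convex
face lists — the uniform SAW lies off all sixteen Yang–Baxter curves. [cite: BeatonGuttmannJensen2012, p. 2]
[cite: GlazmanManolescu2019, p. 1 (no such observable is known for the uniform square-lattice walk)] -/
theorem not_exactPlaquetteVertexRelationRC_uniform {x t : ℂ} {c : Fin 4 → ℂ} (hx : x ≠ 0) (ht : t ≠ 0)
    (hc : c ≠ 0) : ¬ ExactPlaquetteVertexRelationRC ⟨x, x, x, 0, 0⟩ t c :=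
  not_exactPlaquetteVertexRelationRC_noTouch ht hx hx hx rfl rfl hc

/-- **Barrier `PlaquetteWalkHoleRootDefectInterior`** (named statement): there is a finite face list,
a boundary root and an INTERIOR face at which the printed Yang–Baxter weights (`θ = π/3`) with the
Yang–Baxter coefficients violate the exact vertex relation. A THEOREM of this file
(`PlaquetteWalkHoleRootDefectInterior_holds`), not a cited claim.

BARRIER (structured block, D-0021):
- technique_class: plaquette-local linear vertex relations `Σ_s c_s F(z_s) = 0` with a constant coefficient vector for the Glazman–Manolescu plaquette walk on `ℤ²`, demanded at every INTERIOR face (four neighbours in the list) of every finite face list for EVERY boundary root — hole roots included — i.e. the predicate `ExactPlaquetteVertexRelationInt W t c` of `PlaquetteWalkSpinRigidity` (Duminil-Copin–Smirnov's quantifier), here refuted AT the printed Yang–Baxter weights `W(π/3)`, `t = e^{−5iπ/16}`, `c = (1, r(π/3), −1, −r(π/3))`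
- blocks: using the printed Yang–Baxter identity with walks started on the boundary of a HOLE of a multiply connected face domain, even when the relation is only needed at interior faces; nothing is said about OUTER roots (there the identity holds on every finite face list: `PlaquetteWalkYBIdentityOuter_holds`) nor about isthmus hole roots at non-root plaquettes (`PlaquetteWalkIsthmusRoot`)
- because: the nineteen walks from the `E` side of the hole of `dom11` to the sides of the interior face `(2,2)` (kernel enumeration `termsN_dom11`) give, for `W(π/3)`, the value `F·t⁷ = 2x_c¹⁸(y³ − y¹⁵) ≠ 0` (`vertexFunctional_printed_dom11`, certificate over `2x_c = y² − y⁶ + y¹⁰ − y¹⁴`, `y¹⁶ = −1`)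
- evasions_known: outer roots / hole-free or row-convex face lists (print's standing hypothesis «Ω simply connected, a ∈ ∂Ω» [cite: DuminilCopinSmirnov2012, §2 and proof of Lemma 1 (arXiv p. 4)]); isthmus hole roots away from the root plaquette; root-dependent correction terms
- scope_caveats: this named statement refutes ONE weight system (the printed `θ = π/3` member) by an explicit witness; that the interior-faces class is moreover EMPTY on the whole five-weight family with `u₁u₂v ≠ 0` (as the all-faces class is, `PlaquetteWalkNoAllRootsRelation`) is the companion statement `PlaquetteWalkNoInteriorRootsRelation_holds` of this file, which excludes the branches `u₁ = 0` / `u₂ = 0` / `v = 0`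
- status: established — `PlaquetteWalkHoleRootDefectInterior_holds` (this file); in print the relation is stated only for simply connected domains [cite: DuminilCopinSmirnov2012, Lemma 1] [cite: GlazmanManolescu2019, Lemma 2.1] (CONSOLIDATION, negative datum)
[cite: DuminilCopinSmirnov2012, Lemma 1] [cite: GlazmanManolescu2019, Lemma 2.1] -/
def _root_.Literature.Barriers.CriticalPhenomena.PlaquetteWalkHoleRootDefectInterior : Prop :=
  ∃ (Dl : List Face) (a : MidEdge) (f₀ : Face), f₀ ∈ Dl ∧ IsInteriorFace Dl f₀ ∧ IsBoundaryRoot Dl a ∧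
    vertexFunctional (printedWeights (π / 3)) tFiveEighths (ybCoeff (π / 3)) Dl a f₀ ≠ 0

/-- **`PlaquetteWalkHoleRootDefectInterior` holds** (witness: `dom11`, its `E` hole root, the face `(2,2)`).
[cite: DuminilCopinSmirnov2012, Lemma 1] -/
theorem _root_.Literature.Barriers.CriticalPhenomena.PlaquetteWalkHoleRootDefectInterior_holds :
    PlaquetteWalkHoleRootDefectInterior :=
  ⟨dom11, holeRootE, (2, 2), face22_mem_dom11, isInteriorFace_dom11, isBoundaryRoot_holeRootE,
    vertexFunctional_printed_dom11_ne_zero⟩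

end Literature.Barriers.CriticalPhenomena.PlaquetteWalk
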